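import Summits.QuantumFields.BalabanUV.Beta.CompositeOneShotJets

/-!
# `BalabanUV.Beta.CompositeMixedTableGraded` — row D1 ∕ (C1) (an2, `compMixKer`'s owner): THE COMPOSITE MIXED THIRD-ORDER KERNEL WITH THE
# GRADED-SYMMETRIC CROSS PAIRING — the object the second-order Ward row `a2` is inhabited by, BY VALUE (located 2026-08-29)

WHAT.  `CompositeMixedTable.compMixKer ℓ 𝓋 𝒽 𝓉 L` (F6c) is the five-summand top-peeled chain rule S1 + S2 + S3 + S4 + S5 (see that file's header).
With an ANTISYMMETRIC Hessian brick `𝒽` (an1's rooted and (0.4)-symmetrised bricks: `hessKerAt_swap`, `symHessKerAt_swap`) the two CROSS WORDS satisfy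
`S3(f,f′) = −S2(f′,f)`, so `S2 + S3` — and the `𝓋`-word S4 — are `(f,f′)`-ODD and drop out of every even half (an2 PART 32
`CombMixedT2EvenStoreyRec.even_S23_eq_zero ∕ even_S4_eq_zero`; road «FP» `CompositeMixedEvenHalf`, brick-generic): the even half any second-order row consumes is
`S1ᵉ + S5ᵉ`.  THIS FILE defines the GRADED twin
  `compMixKerG ℓ 𝓋 𝒽 𝓉 L (m+1) := S1 + S2 − S3 + S4 + Σ ℓ · compMixKerG … m`
(the third summand's sign flipped at every depth; everything else verbatim), whose even half is `S1ᵉ + (S2 − S3)ᵉ + S5ᵉ = S1ᵉ + 2·S2ᵉ + S5ᵉ` — the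
graded-SYMMETRIC cross pairing `S2(f,f′) + S2(f′,f)` restored — together with its packed table `compMixFFG` and the (0.4)-sym literal-level family `compMixG`
(the twins of F6c's `compMixFF` and `CompositeOneShotJets.compMix`).  §1 the definition + unfoldings; §2 the bridge to `compMixKer`:
`compMixKerG (m+1) = compMixKer (m+1) − 2·S3 + Σ ℓ·(compMixKerG m − compMixKer m)` (pure algebra, brick-free) and the depth-one anchor
`compMixKerG 1 = compMixKer 1`; §3 the packed shapes.  `compMixKer` itself is UNTOUCHED (PART 32∕33c and (K2b)'s typed rows are ITS theorems and stay true).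

WHY (located, BY VALUE — zero weight on any binder).  Engine C's locator for v10's second-order Ward row `a2` (R-AN2-80-GH + ADD1–3, `run/shared/lean/ttrl/requests.jsonl`
l.4560∕4564∕4565∕4566; deposits `prestab/a2/A2.md`, `A2-LOCATE-INTERIM.md`, job `j333652/a2gh_p4_mu0.json` 06482a3e…; (p, Lc) = (4, 3), storey n = 0, μ = 0): v10's `a2`
is NOT inhabited with `hM₂ := ½•(mixFF + sgnK (trK mixFF))` of `compMixKer` (the `𝓉`-only even half), under any rescaling, gauge of the direction column, row family or
levelwise jet; it IS inhabited — the row VANISHES ENTRYWISE on every probe class, `r_sec ≤ 5.4e−13` — at v10's DISPLAYED `(w 0 1, w 0 0) = (−Lc⁸, −1)` once the mixed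
table's even half is `S1ᵉ + 2·S2ᵉ + S5ᵉ` (free fit returns the weights `(54, 108, 54)` to 1e−14, i.e. `cM₂ 0 = 27 = 3³` with the cross pairing at the SAME weight; the
planted sign-back `S1 + S2 + S3 + S5` re-opens the row to 0.29–0.91).  Journal `HOME/CLAIMS.log` [AN2-G80-RCPT-10]; road FP PREDICTION-FP-61 RIGHT; design = the
row's [AN2-G80-RCPT-10] (4).  This file is (F0) of that design: the OBJECT only — no Ward row, no display, no END.

[our object — bookkeeping] three definitions (`compMixKerG`, `compMixFFG`, `compMixG`) + [folklore] unfoldings ∕ finite-sum algebra; nothing cited; 0 sorry.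
Nothing of Bałaban's asserted, valued or discharged (the located sign is in OUR chain rule for OUR transcription; whether Bałaban's own mixed table carries the
symmetric cross pairing is not a question this tree can put — ABSOLUTE RULE); 0 estimates; 0∕4 row-D1 binders (hW ∕ hR ∕ D1Tel ∕ D1Rep); NOT (C1), NOT D1,
NEVER «G-an2-4 closed», NOT BetaPertH, NOT continuum, NOT Clay.
HONEST DEPENDENCY (page 1, mandatory): continuum YM on T⁴ ⇐ BetaPertH ∧ nine spine estimates (0/9 proved); BetaPertH ⇐ (D1) ∧ (D4) ∧ CAP+tail;
G-an2-4 gates asym, D1 and NE2/3/4.  Row D1 ∕ (C1) OWNER an2, gen 80, 2026-08-29.  No existing file touched.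
-/

noncomputable section

open scoped BigOperators

namespace Summit.QuantumFields.BalabanUV.Beta.CompositeMixedTableGraded

open Finset
open Literature.MathematicalPhysics.QuantumFieldTheory.Balaban1983to89
open Literature.MathematicalPhysics.QuantumFieldTheory.Balaban1983to89.Beta
open AffineAveraging (Site toSite)
open AveragingHessianKernels (Bond)
open ExpKernelCalculus (MKer)
open OneStepResolventKernel (Fib)
open Summit.QuantumFields.BalabanUV.Beta.CompositeVertexKernelRec (offs compLinKer compVHKer compLinKer_zero compVHKer_zero)
open Summit.QuantumFields.BalabanUV.Beta.CompositeHessianTable (packFF packFF_inl_inl)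
open Summit.QuantumFields.BalabanUV.Beta.CompositeMixedTable (compMixKer compMixFF compMixKer_zero compMixKer_succ)
open Summit.QuantumFields.BalabanUV.Beta.SymAveragingHessianCounts (symLinKerAt symVhKerAt symHessKerAt)
open Summit.QuantumFields.BalabanUV.Beta.SymAveragingMixedJetTables (symMixKerAt)

variable {d : ℕ}

/-! ## §1 The graded composite mixed kernel -/

variable (ℓ : ℕ → Fin (d + 1) → Site (d + 1) → Bond (d + 1) → ℝ)
  (𝓋 𝒽 : ℕ → Fin (d + 1) → Site (d + 1) → Bond (d + 1) → Bond (d + 1) → ℝ)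
  (𝓉 : ℕ → Fin (d + 1) → Site (d + 1) → Bond (d + 1) → Bond (d + 1) → Bond (d + 1) → ℝ) (L : ℕ)

/-- [our object — bookkeeping] **THE GRADED COMPOSITE MIXED THIRD-ORDER KERNEL** (slots: background bond `g`; fluctuation bonds `f`, `f′`): F6c's `compMixKer`
recursion VERBATIM except that the third summand (the cross word `𝒽 · compLinKer f · compVHKer f′ g`) enters with a MINUS sign, at every depth — so that, for an
antisymmetric `𝒽`, the cross words contribute the `(f,f′)`-SYMMETRIC pairing `S2(f,f′) + S2(f′,f)` instead of the odd one. -/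
def compMixKerG : ℕ → Fin (d + 1) → Site (d + 1) → Bond (d + 1) → Bond (d + 1) → Bond (d + 1) → ℝ
  | 0, _, _, _, _, _ => 0
  | m + 1, μ, y, g, f, f' =>
      (∑ κ : Fin (d + 1), ∑ e ∈ offs L, ∑ κ₁ : Fin (d + 1), ∑ e₁ ∈ offs L, ∑ κ₂ : Fin (d + 1), ∑ e₂ ∈ offs L,
          𝓉 m μ y (κ, (L : ℤ) • y + e) (κ₁, (L : ℤ) • y + e₁) (κ₂, (L : ℤ) • y + e₂)
            * compLinKer ℓ L m g (κ, (L : ℤ) • y + e) * compLinKer ℓ L m f (κ₁, (L : ℤ) • y + e₁)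
            * compLinKer ℓ L m f' (κ₂, (L : ℤ) • y + e₂))
        + (∑ κ₁ : Fin (d + 1), ∑ e₁ ∈ offs L, ∑ κ₂ : Fin (d + 1), ∑ e₂ ∈ offs L,
            𝒽 m μ y (κ₁, (L : ℤ) • y + e₁) (κ₂, (L : ℤ) • y + e₂)
              * compVHKer ℓ 𝓋 L m κ₁ ((L : ℤ) • y + e₁) f g * compLinKer ℓ L m f' (κ₂, (L : ℤ) • y + e₂))
        - (∑ κ₁ : Fin (d + 1), ∑ e₁ ∈ offs L, ∑ κ₂ : Fin (d + 1), ∑ e₂ ∈ offs L,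
            𝒽 m μ y (κ₁, (L : ℤ) • y + e₁) (κ₂, (L : ℤ) • y + e₂)
              * compLinKer ℓ L m f (κ₁, (L : ℤ) • y + e₁) * compVHKer ℓ 𝓋 L m κ₂ ((L : ℤ) • y + e₂) f' g)
        + (∑ κ₁ : Fin (d + 1), ∑ e₁ ∈ offs L, ∑ κ : Fin (d + 1), ∑ e ∈ offs L,
            𝓋 m μ y (κ₁, (L : ℤ) • y + e₁) (κ, (L : ℤ) • y + e)
              * compVHKer ℓ 𝒽 L m κ₁ ((L : ℤ) • y + e₁) f f' * compLinKer ℓ L m g (κ, (L : ℤ) • y + e))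
        + ∑ κ : Fin (d + 1), ∑ e ∈ offs L,
            ℓ m μ y (κ, (L : ℤ) • y + e) * compMixKerG m κ ((L : ℤ) • y + e) g f f'

/-- [our object — bookkeeping] **THE PACKED GRADED COMPOSITE MIXED TABLE** (the shape of F6c's `compMixFF`): per finest background bond `(κ, u)` and
level-`m` bond `(μ, y)`, the field–field kernel `((x, inl α), (x′, inl α′)) ↦ compMixKerG … m μ y (κ, u) (α, x) (α′, x′)`. -/
def compMixFFG (m : ℕ) (κ : Fin (d + 1)) (u : Site (d + 1)) : Fin (d + 1) → Site (d + 1) → MKer (d + 1) (Fib d) :=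
  packFF (fun μ y f f' => compMixKerG ℓ 𝓋 𝒽 𝓉 L m μ y (κ, u) f f')

variable {ℓ 𝓋 𝒽 𝓉 L}

/-- unfolding, depth `0`. -/
@[simp] theorem compMixKerG_zero (μ : Fin (d + 1)) (y : Site (d + 1)) (g f f' : Bond (d + 1)) :
    compMixKerG ℓ 𝓋 𝒽 𝓉 L 0 μ y g f f' = 0 := rfl

/-- unfolding, depth `m+1` (TOP-PEEL by `rfl`; the third summand carries the minus sign). -/
theorem compMixKerG_succ (m : ℕ) (μ : Fin (d + 1)) (y : Site (d + 1)) (g f f' : Bond (d + 1)) :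
    compMixKerG ℓ 𝓋 𝒽 𝓉 L (m + 1) μ y g f f' =
      (∑ κ : Fin (d + 1), ∑ e ∈ offs L, ∑ κ₁ : Fin (d + 1), ∑ e₁ ∈ offs L, ∑ κ₂ : Fin (d + 1), ∑ e₂ ∈ offs L,
          𝓉 m μ y (κ, (L : ℤ) • y + e) (κ₁, (L : ℤ) • y + e₁) (κ₂, (L : ℤ) • y + e₂)
            * compLinKer ℓ L m g (κ, (L : ℤ) • y + e) * compLinKer ℓ L m f (κ₁, (L : ℤ) • y + e₁)
            * compLinKer ℓ L m f' (κ₂, (L : ℤ) • y + e₂))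
        + (∑ κ₁ : Fin (d + 1), ∑ e₁ ∈ offs L, ∑ κ₂ : Fin (d + 1), ∑ e₂ ∈ offs L,
            𝒽 m μ y (κ₁, (L : ℤ) • y + e₁) (κ₂, (L : ℤ) • y + e₂)
              * compVHKer ℓ 𝓋 L m κ₁ ((L : ℤ) • y + e₁) f g * compLinKer ℓ L m f' (κ₂, (L : ℤ) • y + e₂))
        - (∑ κ₁ : Fin (d + 1), ∑ e₁ ∈ offs L, ∑ κ₂ : Fin (d + 1), ∑ e₂ ∈ offs L,
            𝒽 m μ y (κ₁, (L : ℤ) • y + e₁) (κ₂, (L : ℤ) • y + e₂)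
              * compLinKer ℓ L m f (κ₁, (L : ℤ) • y + e₁) * compVHKer ℓ 𝓋 L m κ₂ ((L : ℤ) • y + e₂) f' g)
        + (∑ κ₁ : Fin (d + 1), ∑ e₁ ∈ offs L, ∑ κ : Fin (d + 1), ∑ e ∈ offs L,
            𝓋 m μ y (κ₁, (L : ℤ) • y + e₁) (κ, (L : ℤ) • y + e)
              * compVHKer ℓ 𝒽 L m κ₁ ((L : ℤ) • y + e₁) f f' * compLinKer ℓ L m g (κ, (L : ℤ) • y + e))
        + ∑ κ : Fin (d + 1), ∑ e ∈ offs L,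
            ℓ m μ y (κ, (L : ℤ) • y + e) * compMixKerG ℓ 𝓋 𝒽 𝓉 L m κ ((L : ℤ) • y + e) g f f' := rfl

/-- [folklore] The field–field entries of the packed graded composite mixed table. -/
@[simp] theorem compMixFFG_inl_inl (m : ℕ) (κ : Fin (d + 1)) (u : Site (d + 1)) (μ : Fin (d + 1)) (y x x' : Site (d + 1)) (α α' : Fin (d + 1)) :
    compMixFFG ℓ 𝓋 𝒽 𝓉 L m κ u μ y x x' (Sum.inl α) (Sum.inl α') = compMixKerG ℓ 𝓋 𝒽 𝓉 L m μ y (κ, u) (α, x) (α', x') := rfl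

/-! ## §2 The bridge to `compMixKer` -/

/-- [folklore] **BRIDGE** (brick-free algebra): at depth `m+1` the graded kernel is F6c's kernel MINUS TWICE THE THIRD CROSS WORD plus the top-`ℓ` transport of the
lower difference.  (For an antisymmetric `𝒽`, `−2·S3(f,f′) = 2·S2(f′,f)` — road `CompositeMixedEvenHalf.cross₃_eq_neg_cross₂_swap` — so the even half gains exactly the
symmetric cross pairing `S2(f,f′) + S2(f′,f)`.) -/
theorem compMixKerG_succ_eq_compMixKer_succ_sub (m : ℕ) (μ : Fin (d + 1)) (y : Site (d + 1)) (g f f' : Bond (d + 1)) :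
    compMixKerG ℓ 𝓋 𝒽 𝓉 L (m + 1) μ y g f f' =
      compMixKer ℓ 𝓋 𝒽 𝓉 L (m + 1) μ y g f f'
        - 2 * (∑ κ₁ : Fin (d + 1), ∑ e₁ ∈ offs L, ∑ κ₂ : Fin (d + 1), ∑ e₂ ∈ offs L,
            𝒽 m μ y (κ₁, (L : ℤ) • y + e₁) (κ₂, (L : ℤ) • y + e₂)
              * compLinKer ℓ L m f (κ₁, (L : ℤ) • y + e₁) * compVHKer ℓ 𝓋 L m κ₂ ((L : ℤ) • y + e₂) f' g)
        + ∑ κ : Fin (d + 1), ∑ e ∈ offs L,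
            ℓ m μ y (κ, (L : ℤ) • y + e)
              * (compMixKerG ℓ 𝓋 𝒽 𝓉 L m κ ((L : ℤ) • y + e) g f f' - compMixKer ℓ 𝓋 𝒽 𝓉 L m κ ((L : ℤ) • y + e) g f f') := by
  rw [compMixKerG_succ, compMixKer_succ]
  simp only [mul_sub, Finset.sum_sub_distrib]
  ring

/-- [folklore] ANCHOR: at depth one the graded kernel IS F6c's kernel (no lower composite ⇒ no cross word, no `𝓋`-word):
`compMixKerG … 1 = compMixKer … 1` pointwise. -/
theorem compMixKerG_one (μ : Fin (d + 1)) (y : Site (d + 1)) (g f f' : Bond (d + 1)) :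
    compMixKerG ℓ 𝓋 𝒽 𝓉 L 1 μ y g f f' = compMixKer ℓ 𝓋 𝒽 𝓉 L 1 μ y g f f' := by
  rw [compMixKerG_succ, compMixKer_succ]
  simp only [compMixKerG_zero, compMixKer_zero, compVHKer_zero, mul_zero, zero_mul, Finset.sum_const_zero, sub_zero, add_zero]

/-! ## §3 The (0.4)-symmetrised literal-level family -/

/-- [our object — bookkeeping] **THE GRADED COMPOSITE MIXED TABLE AT THE LITERAL's BRICKS** (the twin of `CompositeOneShotJets.compMix r L m`): the packed graded
kernel over an1's (0.4)-symmetrised bricks `symLinKerAt ∕ symVhKerAt ∕ symHessKerAt ∕ symMixKerAt` at the constant root `toSite r`. -/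
def compMixG (r : Fin (d + 1) → ℕ) (L m : ℕ) : Fin (d + 1) → Site (d + 1) → Fin (d + 1) → Site (d + 1) → MKer (d + 1) (Fib d) :=
  compMixFFG (fun _ => symLinKerAt (toSite r) L) (fun _ => symVhKerAt (toSite r) L) (fun _ => symHessKerAt (toSite r) L)
    (fun _ => symMixKerAt (toSite r) L) L m

/-- [folklore] The field–field entries of the literal-level graded table, by name. -/
theorem compMixG_inl_inl (r : Fin (d + 1) → ℕ) (L m : ℕ) (κ : Fin (d + 1)) (u : Site (d + 1)) (μ : Fin (d + 1)) (y x x' : Site (d + 1))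
    (α α' : Fin (d + 1)) :
    compMixG r L m κ u μ y x x' (Sum.inl α) (Sum.inl α')
      = compMixKerG (fun _ => symLinKerAt (toSite r) L) (fun _ => symVhKerAt (toSite r) L) (fun _ => symHessKerAt (toSite r) L)
          (fun _ => symMixKerAt (toSite r) L) L m μ y (κ, u) (α, x) (α', x') := rfl

end Summit.QuantumFields.BalabanUV.Beta.CompositeMixedTableGraded

end
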